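/-
Copyright (c) 2026. All rights reserved.
Released under Apache 2.0 license as described in the file LICENSE.
Authors: abc-iut cell, S-chain team seat abc-iut-s2-p12 (gen 7; D-0079 R-W lane U «U2-LATTICE-INTEGERS»), over
abc-iut-c312-3's `UnitLogInnerRadiusTie*` and abc-iut-w6-d060's `UnitLogBoundaryRamification*` / `UnitLogKernel`.
-/
import Literature.IUT.LogVolume.UnitLogInnerRadiusTieTorsionWitness
import HarnessLib

/-!
# The inner radius at a TIE index `e = A·(p−1)`, IIIc: `⟸` — a TORSION WITNESS fills the critical ball;
# the criterion `{‖z‖ ≤ ‖ϖ‖^A} ⊆ log_p(𝒪_K^×) ⟺ ∃ ζ' ∈ μ(K) ∖ K^p, u : ‖u^p − ζ'‖ ≤ ‖p‖·‖ϖ‖^A`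

Proof-only sequel (theorems, no definitions, no named fact) of `UnitLogInnerRadiusTieTorsion.lean` /
`UnitLogInnerRadiusTieTorsionWitness.lean`.  Setting as there: `K` a proper ultrametric normed `ℚ_p`-algebra
field, `p` ODD, `ϖ` a norm uniformizer, `e = absRamificationIdx p K = A·(p−1)` (ANY `A`, `p ∣ A` allowed),
`c = ϖ^e/p`, residue polynomial `P(ā) = ā + c̄·ā^p`.

* §3 `exists_norm_addPoly_add_intCast_mul_sub_lt_one` — transfer of the finite-field index lemma: if `b₀ ∈ 𝒪`
  is a NON-VALUE of `P`, every `b ∈ 𝒪` is `a + c·a^p + j·b₀ (mod 𝔪)`;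
  **`closedBall_level_subset_logUnits_of_torsionWitness`**: if `ζ'` is a root of unity of `K`, not a `p`-th
  power in `K`, and `‖u^p − ζ'‖ ≤ ‖p‖·‖ϖ‖^A`, then `{‖z‖ ≤ ‖ϖ‖^A} ⊆ log_p(𝒪_K^×)`: `z₀ := log_p u ∈ 𝔪^A`
  and `z₀/ϖ^A` is a NON-VALUE of `P` (else `u = ρ·y·v` with `y ∈ U^{(A)}`, `v ∈ U^{(A+1)}`, `log_p ρ = 0`,
  so `ρ` is torsion, and `ρ^p = ζ'·w'` with `w' ∈ U^{(A+e)}`, `L(w') = 0`, whence `w' = 1`, `ζ' = ρ^p`);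
  so every `z ∈ 𝔪^A` is `L(1 + ϖ^A a) + j·z₀` modulo `𝔪^{A+1} ⊆ log_p(𝒪^×)`.
* §4 **THE CRITERION** `closedBall_level_subset_logUnits_iff_torsionWitness` (with `ζ_p ∈ K`; classically:
  iff `K(μ_{p^{m+1}})/K` is unramified of degree `p`, `p^m = #μ_{p^∞}(K)` — that reformulation is not typed),
  and `closedBall_level_subset_logUnits_of_exists_torsionWitness` (`r_in ≤ A` given a witness); a witness
  whose root of unity is a `p`-th root forces `p ∣ A` (`dvd_level_of_torsionWitness_of_pow_prime_eq_one`).  Together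
  with `UnitLogValuationSpectrum` (`(p−1) ∤ e`) and `UnitLogInnerRadiusTie*` (`p ∤ A`) this decides
  `r_in ∈ {A, A+1}` at every index over odd `p` from the data «`ζ_p ∈ K`?» and «torsion witness?».

References: [cite: NeukirchANT1999, Ch. II Prop. (5.5)–(5.7)] [cite: SerreLocalFields1979, Ch. XIV §4]
[cite: Washington1997, §5.1].  Classical; `logUnits` is the cell's typing of [IUTchIV] Prop. 1.2's
`log_p(R^×)` ([claim: Mochizuki2012, status: disputed] for that locution only).  Consumer (record only): D-0079
R-W lane U column «rho_in» at tie places with `p ∣ A` (layers `e = l(l−1)`, `2l(l−1)` at `p = l`).  Nothing here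
is disputed mathematics; no IUT statement is asserted; nothing bears on [IUTchIII] Cor. 3.12.
-/

noncomputable section

open Metric Set IsUltrametricDist IsLocalRing
open scoped NormedField

namespace Literature.IUT.LogVolume

open Literature.NumberTheory.GaloisRepresentations.Ultrametric BoundaryRamification

namespace LogEnvelope

section Field

variable (p : ℕ) [hp : Fact p.Prime]
variable {K : Type*} [NontriviallyNormedField K] [instK : NormedAlgebra ℚ_[p] K] [IsUltrametricDist K]
  [ProperSpace K]
variable {ϖ : Kˣ} (hϖ : IsUniformizer ϖ) {A : ℕ} (hA : absRamificationIdx p K = A * (p - 1))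
include hϖ hA

/-! ### §3. `⟸`: a torsion witness fills the critical ball -/

omit hA in
/-- **Transfer of §0 to `K`**: if `b₀ ∈ 𝒪` is a NON-VALUE of `a ↦ a + c·a^p (mod 𝔪)`, every `b ∈ 𝒪` is
`a + c·a^p + j·b₀ (mod 𝔪)` for some `a ∈ 𝒪`, `j ∈ ℤ`. [cite: Washington1997, §5.1] -/
theorem exists_norm_addPoly_add_intCast_mul_sub_lt_one {b₀ : K} (hb₀ : ‖b₀‖ ≤ 1)
    (hnv : ∀ a : K, ‖a‖ ≤ 1 → 1 ≤ ‖a + (ϖ : K) ^ absRamificationIdx p K / (p : K) * a ^ p - b₀‖)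
    (b : K) (hb : ‖b‖ ≤ 1) :
    ∃ (a : K) (j : ℤ), ‖a‖ ≤ 1 ∧
      ‖a + (ϖ : K) ^ absRamificationIdx p K / (p : K) * a ^ p + (j : K) * b₀ - b‖ < 1 := by
  have hc1 := norm_coeff_level_eq_one p hϖ
  let C : Valued.integer K :=
    ⟨(ϖ : K) ^ absRamificationIdx p K / (p : K), Valued.integer.mem_iff.mpr hc1.le⟩
  let B₀ : Valued.integer K := ⟨b₀, Valued.integer.mem_iff.mpr hb₀⟩
  let B : Valued.integer K := ⟨b, Valued.integer.mem_iff.mpr hb⟩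
  haveI := charP_residueField p K
  haveI : Finite (IsLocalRing.ResidueField (Valued.integer K)) := finite_residueField
  have hres : ∀ x : IsLocalRing.ResidueField (Valued.integer K),
      x + residue (Valued.integer K) C * x ^ p ≠ residue (Valued.integer K) B₀ := by
    intro x hx
    obtain ⟨a, rfl⟩ := residue_surjective x
    have h1 : residue (Valued.integer K) (a + C * a ^ p - B₀) = 0 := by
      rw [map_sub, residue_add_mul_pow, hx, sub_self]
    rw [residue_eq_zero_iff_norm_lt_one, coe_add_mul_pow_sub] at h1
    exact (not_lt.mpr (hnv a (Valued.integer.norm_le_one a))) h1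
  obtain ⟨x, j, hxj⟩ := exists_addPoly_add_intCast_mul_eq p (residue (Valued.integer K) C) _ hres
    (residue (Valued.integer K) B)
  obtain ⟨a, rfl⟩ := residue_surjective x
  refine ⟨a, j, Valued.integer.norm_le_one a, ?_⟩
  have h1 : residue (Valued.integer K) (a + C * a ^ p + (j : Valued.integer K) * B₀ - B) = 0 := by
    rw [map_sub, map_add, residue_add_mul_pow, map_mul, map_intCast, hxj, sub_self]
  rw [residue_eq_zero_iff_norm_lt_one] at h1
  have hcoe : ((a + C * a ^ p + (j : Valued.integer K) * B₀ - B : Valued.integer K) : K) =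
      (a : K) + (C : K) * (a : K) ^ p + (j : K) * b₀ - b := by
    push_cast; rfl
  rwa [hcoe] at h1

/-- **`⟸`.  A TORSION WITNESS fills the critical ball**: if `ζ'` is a root of unity of `K`, not a `p`-th
power in `K`, and `‖u^p − ζ'‖ ≤ ‖p‖·‖ϖ‖^A` for some `u ∈ K`, then `{‖z‖ ≤ ‖ϖ‖^A} ⊆ log_p(𝒪_K^×)` (`p` odd,
`e = A(p−1)`, ANY `A`).  Mechanism: `z₀ := log_p u ∈ 𝔪^A` and `z₀/ϖ^A` is a non-value of the residue
polynomial; by §0 every `z ∈ 𝔪^A` is `L(1 + ϖ^A a) + j·z₀` modulo `𝔪^{A+1} ⊆ log_p(𝒪^×)`.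
[cite: SerreLocalFields1979, Ch. XIV §4] [cite: NeukirchANT1999, Ch. II (5.5)–(5.7)] -/
theorem closedBall_level_subset_logUnits_of_torsionWitness (hp2 : p ≠ 2) {ζ' u : K} {n : ℕ} (hn : 0 < n)
    (hζ' : ζ' ^ n = 1) (hnot : ∀ η : K, η ^ p ≠ ζ') (hu : ‖u ^ p - ζ'‖ ≤ ‖(p : K)‖ * ‖(ϖ : K)‖ ^ A) :
    closedBall (0 : K) (‖(ϖ : K)‖ ^ A) ⊆ logUnits K := by
  have hρ0 : 0 < ‖(ϖ : K)‖ := norm_units_pos ϖ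
  have hϖA0 : (ϖ : K) ^ A ≠ 0 := pow_ne_zero _ ϖ.ne_zero
  have hpn0 : 0 < ‖(p : K)‖ := norm_pos_iff.mpr (prime_ne_zero p K)
  have hθ := prime_mul_pow_level_mul_rpow_lt_one p hϖ hA
  have hθ1 := pow_level_succ_mul_rpow_lt_one p hϖ hA
  have hr1 := norm_prime_mul_pow_level_lt_one p hϖ hA
  have hrA1 := norm_prime_mul_pow_level_le p hϖ hA
  have hA1 := one_le_level p hA
  have hρA1 : ‖(ϖ : K)‖ ^ A < 1 := pow_lt_one₀ hρ0.le hϖ.1 (by omega)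
  -- `‖ζ'‖ = ‖u‖ = 1`
  have hζ'1 : ‖ζ'‖ = 1 := by
    have h := congrArg norm hζ'
    rw [norm_pow, norm_one] at h
    exact (pow_eq_one_iff_of_nonneg (norm_nonneg _) hn.ne').mp h
  have hζ'0 : ζ' ≠ 0 := norm_pos_iff.mp (by rw [hζ'1]; exact one_pos)
  have hup1 : ‖u ^ p‖ = 1 := by
    have hd : ‖u ^ p - ζ'‖ < ‖ζ'‖ := by rw [hζ'1]; exact hu.trans_lt hr1
    have h : u ^ p = ζ' + (u ^ p - ζ') := by ring
    rw [h, norm_add_eq_max_of_norm_ne_norm (ne_of_gt hd), max_eq_left hd.le, hζ'1]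
  have hu1 : ‖u‖ = 1 := by
    rw [norm_pow] at hup1
    exact (pow_eq_one_iff_of_nonneg (norm_nonneg _) hp.out.ne_zero).mp hup1
  -- `w := u^p/ζ' ∈ U^{(A+e)}`
  set w : K := u ^ p * ζ'⁻¹ with hw_def
  have hw : ‖1 - w‖ ≤ ‖(p : K)‖ * ‖(ϖ : K)‖ ^ A := by
    have h : (1 : K) - w = -((u ^ p - ζ') * ζ'⁻¹) := by
      rw [hw_def, sub_mul, mul_inv_cancel₀ hζ'0]; ring
    rw [h, norm_neg, norm_mul, norm_inv, hζ'1, inv_one, mul_one]; exact hu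
  have hwP : IsPrincipal w := by
    show ‖1 - w‖ < 1
    exact hw.trans_lt hr1
  have hw1 : ‖w‖ = 1 := hwP.norm_eq_one
  have hupw : u ^ p = w * ζ' := by rw [hw_def, inv_mul_cancel_right₀ hζ'0]
  -- `z₀ := log_p u ∈ 𝔪^A`
  set z₀ : K := unitLog u with hz₀_def
  have hpz₀ : (p : K) * z₀ = logSeries w := by
    rw [hz₀_def, ← unitLog_pow p hu1, hupw, unitLog_mul p hw1 hζ'1, unitLog_eq_zero_of_pow_eq_one p hn hζ',
      add_zero, unitLog_of_isPrincipal p hwP]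
  have hz₀A : ‖z₀‖ ≤ ‖(ϖ : K)‖ ^ A := by
    have h : ‖(p : K)‖ * ‖z₀‖ ≤ ‖(p : K)‖ * ‖(ϖ : K)‖ ^ A := by
      rw [← norm_mul, hpz₀]
      exact (norm_logSeries_le_norm p K hθ.le hw).trans hw
    exact le_of_mul_le_mul_left h hpn0
  have hb₀ : ‖z₀ / (ϖ : K) ^ A‖ ≤ 1 := by
    rw [norm_div, norm_pow, div_le_one (pow_pos hρ0 _)]; exact hz₀A
  -- `z₀/ϖ^A` is a NON-VALUE of the residue polynomial
  have hnv : ∀ a : K, ‖a‖ ≤ 1 →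
      1 ≤ ‖a + (ϖ : K) ^ absRamificationIdx p K / (p : K) * a ^ p - z₀ / (ϖ : K) ^ A‖ := by
    intro a ha
    by_contra hlt
    push Not at hlt
    have hle : ‖a + (ϖ : K) ^ absRamificationIdx p K / (p : K) * a ^ p - z₀ / (ϖ : K) ^ A‖ ≤ ‖(ϖ : K)‖ :=
      hϖ.norm_le_of_norm_lt_one _ hlt
    -- `y := 1 + ϖ^A a`, `L(y) ≡ z₀ (mod 𝔪^{A+1})`
    set y : K := 1 + (ϖ : K) ^ A * a with hy_def
    have hy : ‖1 - y‖ ≤ ‖(ϖ : K)‖ ^ A := by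
      rw [hy_def, show (1 : K) - (1 + (ϖ : K) ^ A * a) = -((ϖ : K) ^ A * a) by ring, norm_neg, norm_mul,
        norm_pow]
      exact mul_le_of_le_one_right (pow_nonneg hρ0.le _) ha
    have hyP : IsPrincipal y := by
      show ‖1 - y‖ < 1
      exact hy.trans_lt hρA1
    have hy1 : ‖y‖ = 1 := hyP.norm_eq_one
    have hcong := norm_logSeries_sub_le_level p hϖ hA hp2 ha
    have hdiff : ‖z₀ - logSeries y‖ ≤ ‖(ϖ : K)‖ ^ (A + 1) := by
      have hsplit : z₀ - logSeries y =
          -((ϖ : K) ^ A * (a + (ϖ : K) ^ absRamificationIdx p K / (p : K) * a ^ p - z₀ / (ϖ : K) ^ A)) +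
          -(logSeries (1 + (ϖ : K) ^ A * a) -
            (ϖ : K) ^ A * (a + (ϖ : K) ^ absRamificationIdx p K / (p : K) * a ^ p)) := by
        rw [mul_sub, mul_div_cancel₀ _ hϖA0, hy_def]; ring
      rw [hsplit]
      refine (norm_add_le_max _ _).trans (max_le ?_ ?_)
      · rw [norm_neg, norm_mul, norm_pow, pow_succ]
        exact mul_le_mul_of_nonneg_left hle (pow_nonneg hρ0.le _)
      · rw [norm_neg]; exact hcong
    obtain ⟨v, hv, hLv⟩ := exists_logSeries_eq p K hθ1 hdiff
    have hvA : ‖1 - v‖ ≤ ‖(ϖ : K)‖ ^ A :=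
      hv.trans (pow_le_pow_of_le_one hρ0.le hϖ.1.le (Nat.le_succ A))
    have hvP : IsPrincipal v := by
      show ‖1 - v‖ < 1
      exact hvA.trans_lt hρA1
    have hv1 : ‖v‖ = 1 := hvP.norm_eq_one
    have hyv1 : ‖y * v‖ = 1 := by rw [norm_mul, hy1, hv1, mul_one]
    have hyv0 : y * v ≠ 0 := norm_pos_iff.mp (by rw [hyv1]; exact one_pos)
    have hyvi1 : ‖(y * v)⁻¹‖ = 1 := by rw [norm_inv, hyv1, inv_one]
    -- `ρ := u/(y v)` is torsion
    set ρ : K := u * (y * v)⁻¹ with hρ_def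
    have hρ1 : ‖ρ‖ = 1 := by rw [hρ_def, norm_mul, hu1, hyvi1, mul_one]
    have hLρ : unitLog ρ = 0 := by
      rw [hρ_def, unitLog_mul p hu1 hyvi1, unitLog_inv p hyv1, unitLog_mul p hy1 hv1,
        unitLog_of_isPrincipal p hyP, unitLog_of_isPrincipal p hvP, hLv, ← hz₀_def]
      ring
    obtain ⟨N, hN0, hN⟩ := (unitLog_eq_zero_iff p K hρ1).mp hLρ
    -- `ρ^p = ζ'·w'` with `w' := w/(y v)^p ∈ U^{(A+e)}`
    have hyv : ‖1 - (y * v) ^ p‖ ≤ ‖(p : K)‖ * ‖(ϖ : K)‖ ^ A := by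
      have h0 : ‖1 - y * v‖ ≤ ‖(ϖ : K)‖ ^ A := norm_one_sub_mul_le_of_le hρA1 hy hvA
      have h := norm_one_add_pow_prime_sub_one_le_prime_mul p hϖ hA (x := y * v - 1)
        (by rwa [norm_sub_rev] at h0)
      rwa [add_sub_cancel, norm_sub_rev] at h
    set w' : K := w * ((y * v) ^ p)⁻¹ with hw'_def
    have hw' : ‖1 - w'‖ ≤ ‖(p : K)‖ * ‖(ϖ : K)‖ ^ A :=
      norm_one_sub_mul_le_of_le hr1 hw (norm_one_sub_inv_le_of_le hr1 hyv)
    have hw'P : IsPrincipal w' := by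
      show ‖1 - w'‖ < 1
      exact hw'.trans_lt hr1
    have hw'1 : ‖w'‖ = 1 := hw'P.norm_eq_one
    have hρp : ρ ^ p = ζ' * w' := by
      rw [hρ_def, mul_pow, inv_pow, hupw, hw'_def]; ring
    have hLw' : logSeries w' = 0 := by
      have h : unitLog (ρ ^ p) = 0 := by rw [unitLog_pow p hρ1, hLρ, mul_zero]
      rw [hρp, unitLog_mul p hζ'1 hw'1, unitLog_eq_zero_of_pow_eq_one p hn hζ', zero_add,
        unitLog_of_isPrincipal p hw'P] at h
      exact h
    have hw'one : w' = 1 := by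
      have h1 : ‖(1 : K) - 1‖ ≤ ‖(ϖ : K)‖ ^ (A + 1) := by
        rw [sub_self, norm_zero]; exact pow_nonneg hρ0.le _
      refine logSeries_injOn p K hθ1 (hw'.trans hrA1) h1 ?_
      rw [hLw', logSeries_one]
    exact hnot ρ (by rw [hρp, hw'one, mul_one])
  -- cover the critical ball
  intro z hz
  rw [mem_closedBall, dist_zero_right] at hz
  have hb : ‖z / (ϖ : K) ^ A‖ ≤ 1 := by
    rw [norm_div, norm_pow, div_le_one (pow_pos hρ0 _)]; exact hz
  obtain ⟨a, j, ha, hab⟩ :=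
    exists_norm_addPoly_add_intCast_mul_sub_lt_one p hϖ hb₀ hnv (z / (ϖ : K) ^ A) hb
  have hab' : ‖a + (ϖ : K) ^ absRamificationIdx p K / (p : K) * a ^ p + (j : K) * (z₀ / (ϖ : K) ^ A) -
      z / (ϖ : K) ^ A‖ ≤ ‖(ϖ : K)‖ := hϖ.norm_le_of_norm_lt_one _ hab
  set y : K := 1 + (ϖ : K) ^ A * a with hy_def
  have hyP : IsPrincipal y := by
    show ‖1 - y‖ < 1
    rw [hy_def, show (1 : K) - (1 + (ϖ : K) ^ A * a) = -((ϖ : K) ^ A * a) by ring, norm_neg, norm_mul,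
      norm_pow]
    exact (mul_le_of_le_one_right (pow_nonneg hρ0.le _) ha).trans_lt hρA1
  have hcong := norm_logSeries_sub_le_level p hϖ hA hp2 ha
  have hdiff : ‖z - (j : K) * z₀ - logSeries y‖ ≤ ‖(ϖ : K)‖ ^ (A + 1) := by
    have hzb : z = (ϖ : K) ^ A * (z / (ϖ : K) ^ A) := by rw [mul_div_cancel₀ _ hϖA0]
    have hz₀b : z₀ = (ϖ : K) ^ A * (z₀ / (ϖ : K) ^ A) := by rw [mul_div_cancel₀ _ hϖA0]
    have hsplit : z - (j : K) * z₀ - logSeries y =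
        -((ϖ : K) ^ A * (a + (ϖ : K) ^ absRamificationIdx p K / (p : K) * a ^ p +
            (j : K) * (z₀ / (ϖ : K) ^ A) - z / (ϖ : K) ^ A)) +
        -(logSeries (1 + (ϖ : K) ^ A * a) -
            (ϖ : K) ^ A * (a + (ϖ : K) ^ absRamificationIdx p K / (p : K) * a ^ p)) := by
      rw [hy_def]
      conv_lhs => rw [hzb, hz₀b]
      ring
    rw [hsplit]
    refine (norm_add_le_max _ _).trans (max_le ?_ ?_)
    · rw [norm_neg, norm_mul, norm_pow, pow_succ]
      exact mul_le_mul_of_nonneg_left hab' (pow_nonneg hρ0.le _)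
    · rw [norm_neg]; exact hcong
  have h1 : z - (j : K) * z₀ - logSeries y ∈ logUnits K := by
    refine closedBall_div_succ_subset_logUnits p hϖ ?_
    rw [div_eq_level p hA, mem_closedBall, dist_zero_right]
    exact hdiff
  have h2 : logSeries y ∈ logUnits K := by
    rw [← unitLog_of_isPrincipal p hyP]; exact unitLog_mem_logUnits hyP.norm_eq_one
  have h3 : (j : K) * z₀ ∈ logUnits K := by
    rw [← zsmul_eq_mul]
    exact (logUnitsAddSubgroup p K).zsmul_mem (unitLog_mem_logUnits hu1) j
  have h4 := (logUnitsAddSubgroup p K).add_mem ((logUnitsAddSubgroup p K).add_mem h1 h2) h3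
  have hzeq : z - (j : K) * z₀ - logSeries y + logSeries y + (j : K) * z₀ = z := by ring
  rwa [hzeq] at h4

/-! ### §4. The criterion -/

/-- **THE TORSION-WITNESS CRITERION** (`p` odd, `e = A·(p−1)`, ANY `A`, `ζ_p ∈ K`):
`{‖z‖ ≤ ‖ϖ‖^A} ⊆ log_p(𝒪_K^×)` **iff** some root of unity `ζ' ∈ K` that is not a `p`-th power in `K` has
`‖u^p − ζ'‖ ≤ ‖p‖·‖ϖ‖^A` for some `u ∈ K` (classically: iff `K(μ_{p^{m+1}})/K` is unramified of degree `p`,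
`p^m = #μ_{p^∞}(K)`). [cite: SerreLocalFields1979, Ch. XIV §4] [cite: NeukirchANT1999, Ch. II (5.5)–(5.7)] -/
theorem closedBall_level_subset_logUnits_iff_torsionWitness (hp2 : p ≠ 2) {ζ : K} (hζ : ζ ^ p = 1)
    (hζ1 : ζ ≠ 1) :
    closedBall (0 : K) (‖(ϖ : K)‖ ^ A) ⊆ logUnits K ↔
      ∃ ζ' u : K, (∃ n : ℕ, 0 < n ∧ ζ' ^ n = 1) ∧ (∀ η : K, η ^ p ≠ ζ') ∧
        ‖u ^ p - ζ'‖ ≤ ‖(p : K)‖ * ‖(ϖ : K)‖ ^ A := by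
  refine ⟨exists_torsionWitness_of_closedBall_level_subset_logUnits p hϖ hA hp2 hζ hζ1, ?_⟩
  rintro ⟨ζ', u, ⟨n, hn, hζ'⟩, hnot, hu⟩
  exact closedBall_level_subset_logUnits_of_torsionWitness p hϖ hA hp2 hn hζ' hnot hu

/-- **A torsion witness ⇒ the critical ball IS inside `log_p(𝒪_K^×)`** (so `r_in ≤ A`), restated with the
witness unbundled for table use. [cite: SerreLocalFields1979, Ch. XIV §4] -/
theorem closedBall_level_subset_logUnits_of_exists_torsionWitness (hp2 : p ≠ 2)
    (hex : ∃ ζ' u : K, (∃ n : ℕ, 0 < n ∧ ζ' ^ n = 1) ∧ (∀ η : K, η ^ p ≠ ζ') ∧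
      ‖u ^ p - ζ'‖ ≤ ‖(p : K)‖ * ‖(ϖ : K)‖ ^ A) :
    closedBall (0 : K) (‖(ϖ : K)‖ ^ A) ⊆ logUnits K := by
  obtain ⟨ζ', u, ⟨n, hn, hζ'⟩, hnot, hu⟩ := hex
  exact closedBall_level_subset_logUnits_of_torsionWitness p hϖ hA hp2 hn hζ' hnot hu


/-- **A torsion witness whose root of unity is a `p`-th root forces `p ∣ A`** (`p` odd, `e = A(p−1)`): if
`ζ'^p = 1`, `ζ'` is not a `p`-th power in `K` (so `ζ' ≠ 1`) and `‖u^p − ζ'‖ ≤ ‖p‖·‖ϖ‖^A`, then `u` is a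
principal unit with `‖1 − u^p‖ = ‖1 − ζ'‖ = ‖ϖ‖^A`; were `u` of level `≥ A` this would be `≤ ‖ϖ‖^{A·p}`, so
`u` has level `s < A` and the `p`-th power is EXACT, `‖ϖ‖^A = ‖ϖ‖^{p·s}`, i.e. `A = p·s`.  (Consistency
with abc-iut-c312-3's Part III: for `p ∤ A` and `μ_{p^∞}(K) = μ_p` there is no torsion witness, `r_in = A+1`.)
[cite: SerreLocalFields1979, Ch. XIV §4] [cite: NeukirchANT1999, Ch. II (5.5)–(5.7)] -/
theorem dvd_level_of_torsionWitness_of_pow_prime_eq_one {ζ' u : K} (hζ' : ζ' ^ p = 1)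
    (hnot : ∀ η : K, η ^ p ≠ ζ') (hu : ‖u ^ p - ζ'‖ ≤ ‖(p : K)‖ * ‖(ϖ : K)‖ ^ A) : p ∣ A := by
  have hρ0 : 0 < ‖(ϖ : K)‖ := norm_units_pos ϖ
  have hA1 := one_le_level p hA
  have hρA1 : ‖(ϖ : K)‖ ^ A < 1 := pow_lt_one₀ hρ0.le hϖ.1 (by omega)
  have hpA : ‖(p : K)‖ * ‖(ϖ : K)‖ ^ A < ‖(ϖ : K)‖ ^ A := by
    rw [norm_prime_mul_pow_level p hϖ hA]
    have hp2 := hp.out.two_le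
    exact pow_lt_pow_right_of_lt_one₀ hρ0 hϖ.1 (by nlinarith)
  have hζ'1 : ζ' ≠ 1 := fun h => hnot 1 (by rw [one_pow, h])
  -- the level of `ζ'` is exactly `A`, hence so is that of `u^p`
  have hlev := norm_one_sub_eq_pow_level_of_pow_prime_eq_one p hϖ hA hζ' hζ'1
  have hup : ‖1 - u ^ p‖ = ‖(ϖ : K)‖ ^ A := by
    have hlt : ‖-(u ^ p - ζ')‖ < ‖1 - ζ'‖ := by
      rw [norm_neg, hlev]; exact hu.trans_lt hpA
    have h : (1 : K) - u ^ p = (1 - ζ') + -(u ^ p - ζ') := by ring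
    rw [h, norm_add_eq_max_of_norm_ne_norm (ne_of_gt hlt), max_eq_left hlt.le, hlev]
  have hupP : IsPrincipal (u ^ p) := by
    show ‖1 - u ^ p‖ < 1
    rw [hup]; exact hρA1
  have hu1 : ‖u‖ = 1 := norm_eq_one_of_isPrincipal_pow hp.out.pos hupP
  have huP : IsPrincipal u := IsPrincipal.of_pow_prime (p := p) hu1.le hupP
  by_cases hlevu : ‖(ϖ : K)‖ ^ A < ‖1 - u‖
  · -- below the critical level the `p`-th power is exact: `‖ϖ‖^A = ‖1 − u‖^p = ‖ϖ‖^{s·p}`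
    have h := norm_one_add_pow_prime_sub_one_eq p hϖ hA (x := u - 1) (by rwa [norm_sub_rev])
      (by rw [norm_sub_rev]; exact huP.le)
    rw [add_sub_cancel, norm_sub_rev, hup, norm_sub_rev] at h
    have hx : (1 : K) - u ≠ 0 := norm_pos_iff.mp ((pow_pos hρ0 _).trans hlevu)
    obtain ⟨s, hs⟩ := hϖ.2 (Units.mk0 (1 - u) hx)
    rw [Units.val_mk0] at hs
    have h2 : ‖(ϖ : K)‖ ^ (A : ℤ) = ‖(ϖ : K)‖ ^ (s * (p : ℤ)) := by
      rw [zpow_natCast, h, hs, ← zpow_natCast, ← zpow_mul]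
    have hAs : (A : ℤ) = s * (p : ℤ) := zpow_right_injective₀ hρ0 hϖ.1.ne h2
    exact Int.natCast_dvd_natCast.mp ⟨s, by rw [hAs, mul_comm]⟩
  · -- level `≥ A` would make `u^p` too deep
    push Not at hlevu
    have h := norm_one_add_pow_prime_sub_one_le_prime_mul p hϖ hA (x := u - 1) (by rwa [norm_sub_rev])
    rw [add_sub_cancel, norm_sub_rev, hup] at h
    exact absurd h (not_le.mpr hpA)

end Field

end LogEnvelope

end Literature.IUT.LogVolume

end
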